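import Literature.Probability.Percolation.OrbitLoopPolygon
import Literature.Probability.Percolation.InterfaceLoopClusters
import Literature.Probability.Percolation.BoxCrossingProofs
import Literature.Topology.PlaneTopology.CloseLoopsHomotopy
import HarnessLib

/-!
# The rounded loop of an interface loop is a Jordan loop `4δ`-close to the medial polygon

Topic `Literature/Probability/Percolation`; proofs only. Continuation of `OrbitLoopPolygon.lean`
(the rounded loop `OrbitPolygon.loop ω p δ` of the orbit of a corner `p` under the turning rule)
towards the transfer of quad crossings between close loop configurations
(`Literature.Probability.Percolation.dkkmo_crossing_rotation_invariance`):

* `OrbitPolygon.isJordanLoop_loop`: the rounded loop is a Jordan loop in the sense of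
  `Topology/PlaneTopology/JordanSweepParity.lean` (`IsJordanLoop`), and so is the periodic
  extension of its based loop (`isJordanLoop_perExt_ofPeriodic_loop`, the form consumed by
  `CloseLoopsHomotopy.isJordanLoop_perExt_shift_reparam`);
* `IsInterfaceLoop.minimalPeriod_eq_length`: an interface loop `γ` of the tree's loop
  representation (`IsInterfaceLoop ω γ`, a list of medial vertices) is exactly one period of the
  orbit of the corner of its first dart;
* `IsInterfaceLoop.dist_closedCurve_loop_le`: at every time `t ∈ [0, 1]` the uniformly
  parametrised closed polygon through the midpoints `medialPoint δ γ[k]` (`closedCurve`, whose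
  class is `loopCurve δ 0 γ`, `loopCurve_zero_eq_mk_closedCurve`) and the rounded loop are within
  `4δ`: on `[k/Q, (k+1)/Q]` the former is on the segment between the midpoints of the two edges of
  dart `k` (within `δ/2` of its vertex), the latter on the dart piece `k` or the connector `k+1`
  (within `3δ`, `OrbitPolygon.dist_loop_meshPoint_le`).

## References

* F. Camia, C. M. Newman, Comm. Math. Phys. 268 (2006), §2 [CamiaNewman2006].
* S. Smirnov, C. R. Acad. Sci. Paris 333 (2001), §2 [Smirnov2001].
-/

noncomputable section

namespace Literature.Probability.Percolation

open Set Complex Function LatticeModels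
open scoped Pointwise

namespace OrbitPolygon

variable {β : BondConfig (Site 2)} {p : Site 2 × Fin 4}

/-- **The rounded loop is a Jordan loop** in the sense of
`Literature.Topology.PlaneTopology.IsJordanLoop` (`JordanSweepParity.lean`). [cite: CamiaNewman2006, §2] -/
theorem isJordanLoop_loop (hp : p ∈ periodicPts (nextCorner β)) {δ : ℝ} (hδ : 0 < δ) :
    Literature.Topology.PlaneTopology.IsJordanLoop (loop β p δ) :=
  ⟨continuous_loop, periodic_loop δ, injOn_loop hp hδ⟩

/-- The periodic extension of the based loop of the rounded loop is the rounded loop, hence a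
Jordan loop (the form consumed by `CloseLoopsHomotopy`). [folklore] -/
theorem isJordanLoop_perExt_ofPeriodic_loop (hp : p ∈ periodicPts (nextCorner β)) {δ : ℝ} (hδ : 0 < δ) :
    Literature.Topology.PlaneTopology.IsJordanLoop
      (RandomPlanarGeometry.Curve.ofPeriodic (loop β p δ) continuous_loop).perExt := by
  rw [RandomPlanarGeometry.Curve.perExt_ofPeriodic continuous_loop (periodic_loop δ)]
  exact isJordanLoop_loop hp hδ

end OrbitPolygon

/-! ### The rounded loop is `4δ`-close to the medial polygon `loopCurve` -/

namespace OrbitPolygon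

/-- Scaling of medial points. [folklore] -/
theorem medialPoint_eq_mul_one (δ : ℝ) (e : MedialVertex) :
    medialPoint δ e = (δ : ℂ) * medialPoint 1 e := by
  induction e using Sym2.ind with
  | _ x y => simp only [medialPoint_mk, meshPoint]; push_cast; ring

/-- The shifted points of a dart are within `2δ` of its vertex. [folklore] -/
theorem dist_pS_meshPoint_le {β : BondConfig (Site 2)} {p : Site 2 × Fin 4} {δ : ℝ} (hδ : 0 ≤ δ)
    (j : ℕ) : dist (pS β p δ j) (meshPoint δ (cv β p j)) ≤ 2 * δ := by
  have h1 : pS β p δ j = (δ : ℂ) * dartPt (cv β p j) (cf β p j) (srcDir (cv β p j) (cf β p j)) := by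
    rw [pS, Complex.real_smul]
  have h2 : meshPoint δ (cv β p j) = (δ : ℂ) * Site.toComplex (cv β p j) := rfl
  rw [h1, h2, Complex.dist_eq, ← mul_sub, norm_mul, Complex.norm_real, Real.norm_of_nonneg hδ,
    ← Complex.dist_eq, mul_comm]
  exact mul_le_mul_of_nonneg_right (dist_dartPt_toComplex_le (isCorner (β := β) (p := p) j) _) hδ

/-- The shifted points of a dart are within `2δ` of its vertex. [folklore] -/
theorem dist_pT_meshPoint_le {β : BondConfig (Site 2)} {p : Site 2 × Fin 4} {δ : ℝ} (hδ : 0 ≤ δ)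
    (j : ℕ) : dist (pT β p δ j) (meshPoint δ (cv β p j)) ≤ 2 * δ := by
  have h1 : pT β p δ j = (δ : ℂ) * dartPt (cv β p j) (cf β p j) (tgtDir (cv β p j) (cf β p j)) := by
    rw [pT, Complex.real_smul]
  have h2 : meshPoint δ (cv β p j) = (δ : ℂ) * Site.toComplex (cv β p j) := rfl
  rw [h1, h2, Complex.dist_eq, ← mul_sub, norm_mul, Complex.norm_real, Real.norm_of_nonneg hδ,
    ← Complex.dist_eq, mul_comm]
  exact mul_le_mul_of_nonneg_right (dist_dartPt_toComplex_le (isCorner (β := β) (p := p) j) _) hδ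

/-- Consecutive vertices of the orbit are equal or adjacent: within `δ`. [folklore] -/
theorem dist_meshPoint_cv_succ_le {β : BondConfig (Site 2)} {p : Site 2 × Fin 4} {δ : ℝ}
    (hδ : 0 ≤ δ) (j : ℕ) : dist (meshPoint δ (cv β p (j + 1))) (meshPoint δ (cv β p j)) ≤ δ := by
  rw [cv, cv, corner_succ]
  rcases nextCorner_fst_eq_or β (corner β p j) with h | ⟨-, h⟩
  · rw [h, dist_self]; exact hδ
  · rw [h, dist_comm]
    have hadj : (zdGraph 2).Adj (corner β p j).1 ((corner β p j).1 + cornerUnit ((corner β p j).2 + 1)) := by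
      have := cTgt_mem_edgeSet (corner β p j)
      rwa [cTgt, SimpleGraph.mem_edgeSet] at this
    rw [dist_meshPoint_of_adj hadj, abs_of_nonneg hδ]

/-- **The rounded loop stays within `3δ` of the current vertex**: for `t ∈ [0, 1)` with
`⌊Q t⌋ = k` (`Q` the period) the point `loop t` lies on the dart piece `k` or the connector
`k + 1`, both within `3δ` of `δ · cv k`. [folklore] -/
theorem dist_loop_meshPoint_le {β : BondConfig (Site 2)} {p : Site 2 × Fin 4}
    {δ : ℝ} (hδ : 0 ≤ δ) {t : ℝ} (ht : t ∈ Ico (0 : ℝ) 1) :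
    dist (loop β p δ t) (meshPoint δ (cv β p (⌊(2 * minimalPeriod (nextCorner β) p : ℕ) * t⌋₊ / 2))) ≤
      3 * δ := by
  have hval : loop β p δ t ∈ segment ℝ (vtx β p δ ⌊((2 * minimalPeriod (nextCorner β) p : ℕ) : ℝ) * t⌋₊)
      (vtx β p δ (⌊((2 * minimalPeriod (nextCorner β) p : ℕ) : ℝ) * t⌋₊ + 1)) := by
    have : loop β p δ t = PLLoop.unitLoop (vtx β p δ) (2 * minimalPeriod (nextCorner β) p) t := by
      simp only [loop, Function.comp_apply, Int.fract_eq_self.2 ht]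
    rw [this]
    exact PLLoop.interp_mem_segment (mul_nonneg (Nat.cast_nonneg _) ht.1)
  generalize ⌊((2 * minimalPeriod (nextCorner β) p : ℕ) : ℝ) * t⌋₊ = m at hval ⊢
  -- the ball of radius `3δ` about the vertex contains both ends of the piece
  have hconv : ∀ k, Convex ℝ (Metric.closedBall (meshPoint δ (cv β p k)) (3 * δ)) := fun k =>
    convex_closedBall _ _
  obtain ⟨i, rfl | rfl⟩ := Nat.even_or_odd' m
  · -- dart piece `i`
    have hi : 2 * i / 2 = i := by omega
    rw [hi]
    rw [vtx_two_mul, vtx_two_mul_add_one] at hval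
    refine Metric.mem_closedBall.1 ((hconv i).segment_subset ?_ ?_ hval)
    · exact Metric.mem_closedBall.2 ((dist_pS_meshPoint_le hδ i).trans (by linarith))
    · exact Metric.mem_closedBall.2 ((dist_pT_meshPoint_le hδ i).trans (by linarith))
  · -- connector `i + 1`
    have hi : (2 * i + 1) / 2 = i := by omega
    rw [hi]
    rw [vtx_two_mul_add_one, show 2 * i + 1 + 1 = 2 * (i + 1) by ring, vtx_two_mul] at hval
    refine Metric.mem_closedBall.1 ((hconv i).segment_subset ?_ ?_ hval)
    · exact Metric.mem_closedBall.2 ((dist_pT_meshPoint_le hδ i).trans (by linarith))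
    · refine Metric.mem_closedBall.2 ?_
      calc dist (pS β p δ (i + 1)) (meshPoint δ (cv β p i))
          ≤ dist (pS β p δ (i + 1)) (meshPoint δ (cv β p (i + 1))) +
            dist (meshPoint δ (cv β p (i + 1))) (meshPoint δ (cv β p i)) := dist_triangle _ _ _
        _ ≤ 2 * δ + δ := add_le_add (dist_pS_meshPoint_le hδ _) (dist_meshPoint_cv_succ_le hδ _)
        _ = 3 * δ := by ring

end OrbitPolygon

namespace IsInterfaceLoop

variable {ω : BondConfig (Site 2)} {γ : List MedialVertex}

/-- **An interface loop is one period of the orbit of its first corner**: the minimal period of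
the turning rule at the corner `p` of the dart at position `0` is the length of the loop (the
dart list has no duplicates). [cite: Smirnov2001, §2] -/
theorem minimalPeriod_eq_length (h : IsInterfaceLoop ω γ) {p : Site 2 × Fin 4}
    (hps : cSrc p = γ[0 % γ.length]'(Nat.mod_lt _ h.length_pos))
    (hpt : cTgt p = γ[(0 + 1) % γ.length]'(Nat.mod_lt _ h.length_pos)) :
    minimalPeriod (nextCorner ω) p = γ.length := by
  have hper : IsPeriodicPt (nextCorner ω) γ.length p := by
    have hmem := h.mem_periodicPts (p := p) (by
      have := h.getElem_mod_mem_zip 0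
      rwa [← hps, ← hpt] at this)
    -- `nextCorner^[len] p` has the same source and target as `p`
    obtain ⟨hs, ht⟩ := h.cSrc_nextCorner_iterate hps hpt γ.length
    refine eq_of_cSrc_eq_of_cTgt_eq ?_ ?_
    · rw [hs, hps]; exact getElem_idx_congr (by simp) _
    · rw [ht, hpt]; exact getElem_idx_congr (by simp) _
  have hdvd := hper.minimalPeriod_dvd
  have hpos : 0 < minimalPeriod (nextCorner ω) p :=
    IsPeriodicPt.minimalPeriod_pos h.length_pos hper
  -- if the minimal period `Q` were `< len`, darts `0` and `Q` of the loop would coincide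
  by_contra hne
  have hlt : minimalPeriod (nextCorner ω) p < γ.length :=
    lt_of_le_of_ne (Nat.le_of_dvd h.length_pos hdvd) hne
  set Q := minimalPeriod (nextCorner ω) p with hQ
  obtain ⟨hs, ht⟩ := h.cSrc_nextCorner_iterate hps hpt Q
  have hfix : (nextCorner ω)^[Q] p = p := iterate_minimalPeriod
  rw [hfix, hps] at hs
  rw [hfix, hpt] at ht
  have h0 := h.getElem_zip_rotate_one h.length_pos
  have hq := h.getElem_zip_rotate_one hlt
  have hnd := h.nodup
  rw [List.nodup_iff_injective_getElem] at hnd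
  have hlenz : (γ.zip (γ.rotate 1)).length = γ.length := by simp
  have key : (⟨0, by rw [hlenz]; exact h.length_pos⟩ : Fin (γ.zip (γ.rotate 1)).length) =
      ⟨Q, by rw [hlenz]; exact hlt⟩ := by
    apply hnd
    simp only
    rw [h0, hq]
    refine Prod.ext ?_ ?_
    · simpa [Nat.mod_eq_of_lt hlt] using hs
    · simpa using ht
  have := congrArg Fin.val key
  simp at this
  omega

/-- **The rounded loop is `4δ`-close to the medial polygon, at equal times.** For an interface
loop `γ` of `ω` with first corner `p`, the uniformly parametrised closed polygon through the
midpoints `medialPoint δ γ[k]` (`closedCurve`, whose class is `loopCurve δ 0 γ`) and the rounded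
loop `OrbitPolygon.loop ω p δ` are within `4δ` of each other at every time `t ∈ [0, 1]`: on
`[k/Q, (k+1)/Q]` the former is on the segment between the midpoints of the two edges of dart `k`
(within `δ/2` of its vertex) and the latter on the dart piece `k` or the connector `k + 1`
(within `3δ`). [cite: CamiaNewman2006, §2] -/
theorem dist_closedCurve_loop_le (h : IsInterfaceLoop ω γ) {p : Site 2 × Fin 4}
    (hps : cSrc p = γ[0 % γ.length]'(Nat.mod_lt _ h.length_pos))
    (hpt : cTgt p = γ[(0 + 1) % γ.length]'(Nat.mod_lt _ h.length_pos)) {δ : ℝ} (hδ : 0 ≤ δ)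
    (t : unitInterval) :
    dist (closedCurve (γ.map (medialPoint δ)) t) (OrbitPolygon.loop ω p δ t) ≤ 4 * δ := by
  have hQ := h.minimalPeriod_eq_length hps hpt
  have hn : γ.map (medialPoint δ) ≠ [] := by simpa using h.ne_nil
  have hlen : (γ.map (medialPoint δ)).length = γ.length := List.length_map _
  have hp : p ∈ periodicPts (nextCorner ω) := by
    refine h.mem_periodicPts (p := p) ?_
    have := h.getElem_mod_mem_zip 0
    rwa [← hps, ← hpt] at this
  -- reduce `t = 1` to `t = 0`
  wlog ht1 : (t : ℝ) < 1 generalizing t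
  · have ht : t = 1 := le_antisymm t.2.2 (not_lt.1 ht1)
    have h0 := this 0 (by norm_num)
    rw [ht]
    have hc : closedCurve (γ.map (medialPoint δ)) 1 = closedCurve (γ.map (medialPoint δ)) 0 :=
      ((isLoop_closedCurve _).symm : _)
    have hl : OrbitPolygon.loop ω p δ (1 : unitInterval) = OrbitPolygon.loop ω p δ (0 : unitInterval) := by
      have := OrbitPolygon.periodic_loop (β := ω) (p := p) δ 0
      simpa using this
    rwa [hc, hl]
  have ht : (t : ℝ) ∈ Ico (0 : ℝ) 1 := ⟨t.2.1, ht1⟩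
  set N := γ.length with hN
  have hNpos : 0 < N := h.length_pos
  -- the current dart index
  set m := ⌊((2 * minimalPeriod (nextCorner ω) p : ℕ) : ℝ) * t⌋₊ with hm
  set k := m / 2 with hk
  have hkt : (N : ℝ) * t ∈ Icc (k : ℝ) (k + 1) := by
    have h2 : ((2 * minimalPeriod (nextCorner ω) p : ℕ) : ℝ) * t = 2 * ((N : ℝ) * t) := by
      rw [hQ]; push_cast; ring
    have hnn : 0 ≤ ((2 * minimalPeriod (nextCorner ω) p : ℕ) : ℝ) * t :=
      mul_nonneg (Nat.cast_nonneg _) ht.1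
    have hfl := Nat.floor_le hnn
    have hlt := Nat.lt_floor_add_one (((2 * minimalPeriod (nextCorner ω) p : ℕ) : ℝ) * t)
    rw [← hm, h2] at hfl hlt
    have hk1 : 2 * k ≤ m := by rw [hk]; omega
    have hk2 : m ≤ 2 * k + 1 := by rw [hk]; omega
    have hk1' : (2 * k : ℝ) ≤ m := by exact_mod_cast hk1
    have hk2' : (m : ℝ) ≤ 2 * k + 1 := by exact_mod_cast hk2
    constructor <;> linarith
  have hkN : k < N := by
    have hnn : 0 ≤ (N : ℝ) * t := mul_nonneg (Nat.cast_nonneg _) ht.1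
    have : (k : ℝ) ≤ N * t := hkt.1
    have hlt : (N : ℝ) * t < N := by
      have := mul_lt_mul_of_pos_left ht.2 (by exact_mod_cast hNpos : (0 : ℝ) < N)
      simpa using this
    exact_mod_cast this.trans_lt hlt
  -- the polygon point is on the segment between the midpoints of the two edges of dart `k`
  have hcorner : ∀ j (hj : j < N), γ[j]'hj = cSrc (OrbitPolygon.corner ω p j) := by
    intro j hj
    have := h.getElem_eq_cSrc_iterate hNpos hps hpt hj
    rw [this, OrbitPolygon.corner]
    congr 2
    rw [Nat.sub_zero, Nat.add_mod_right, Nat.mod_eq_of_lt hj]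
  have hsrc : (γ.map (medialPoint δ))[k % (γ.map (medialPoint δ)).length]'(Nat.mod_lt _ (by omega)) =
      medialPoint δ (cSrc (OrbitPolygon.corner ω p k)) := by
    simp only [List.getElem_map, hlen, Nat.mod_eq_of_lt hkN, hcorner k hkN]
  have htgt : (γ.map (medialPoint δ))[(k + 1) % (γ.map (medialPoint δ)).length]'(Nat.mod_lt _ (by omega)) =
      medialPoint δ (cTgt (OrbitPolygon.corner ω p k)) := by
    simp only [List.getElem_map, hlen]
    rw [hcorner _ (Nat.mod_lt _ hNpos), ← cSrc_nextCorner, ← OrbitPolygon.corner_succ,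
      OrbitPolygon.corner, OrbitPolygon.corner, ← hQ, iterate_mod_minimalPeriod_eq]
  have hk' : k < (γ.map (medialPoint δ)).length := by rw [hlen]; exact hkN
  have hpoly : closedCurve (γ.map (medialPoint δ)) t ∈
      segment ℝ (medialPoint δ (cSrc (OrbitPolygon.corner ω p k)))
        (medialPoint δ (cTgt (OrbitPolygon.corner ω p k))) := by
    rw [closedCurve_apply hn, hlen, affineInterp_closed_eq_lineMap hn hk' hkt, hsrc, htgt,
      segment_eq_image_lineMap]
    exact ⟨_, ⟨by linarith [hkt.1], by linarith [hkt.2]⟩, rfl⟩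
  -- both midpoints are within `δ/2` of the vertex
  have hv : ∀ e ∈ ({cSrc (OrbitPolygon.corner ω p k), cTgt (OrbitPolygon.corner ω p k)} : Set _),
      dist (medialPoint δ e) (meshPoint δ (OrbitPolygon.cv ω p k)) ≤ δ / 2 := by
    intro e he
    have key : dist (medialPoint 1 e) (meshPoint 1 (OrbitPolygon.corner ω p k).1) = 1 / 2 := by
      rcases he with rfl | rfl
      · exact dist_medialPoint_cSrc _
      · exact dist_medialPoint_cTgt _
    have e1 : meshPoint δ (OrbitPolygon.cv ω p k) = (δ : ℂ) * meshPoint 1 (OrbitPolygon.corner ω p k).1 := by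
      simp only [OrbitPolygon.cv, meshPoint]; push_cast; ring
    rw [OrbitPolygon.medialPoint_eq_mul_one, e1, Complex.dist_eq, ← mul_sub, norm_mul,
      Complex.norm_real, Real.norm_of_nonneg hδ, ← Complex.dist_eq, key]
    linarith
  have hpoly' : dist (closedCurve (γ.map (medialPoint δ)) t) (meshPoint δ (OrbitPolygon.cv ω p k)) ≤ δ / 2 := by
    refine Metric.mem_closedBall.1 ((convex_closedBall _ _).segment_subset ?_ ?_ hpoly)
    · exact Metric.mem_closedBall.2 (hv _ (Or.inl rfl))
    · exact Metric.mem_closedBall.2 (hv _ (Or.inr rfl))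
  have hloop := OrbitPolygon.dist_loop_meshPoint_le (β := ω) (p := p) hδ ht
  calc dist (closedCurve (γ.map (medialPoint δ)) t) (OrbitPolygon.loop ω p δ t)
      ≤ dist (closedCurve (γ.map (medialPoint δ)) t) (meshPoint δ (OrbitPolygon.cv ω p k)) +
          dist (OrbitPolygon.loop ω p δ t) (meshPoint δ (OrbitPolygon.cv ω p k)) :=
        dist_triangle_right _ _ _
    _ ≤ δ / 2 + 3 * δ := add_le_add hpoly' hloop
    _ ≤ 4 * δ := by linarith

/-- **The loop of the tree's loop representation is the class of this closed polygon**: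
`loopCurve δ 0 γ = CurveClass.mk (closedCurve (γ.map (medialPoint δ)))`. [folklore] -/
theorem loopCurve_zero_eq_mk_closedCurve (δ : ℝ) (γ : List MedialVertex) :
    loopCurve δ 0 γ = RandomPlanarGeometry.CurveClass.mk (closedCurve (γ.map (medialPoint δ))) := by
  rw [loopCurve_eq_closedPolygon, closedPolygon_eq_mk_closedCurve]
  congr 2
  refine List.map_congr_left fun e _ => ?_
  simp

end IsInterfaceLoop

end Literature.Probability.Percolation
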